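import Literature.AlgebraicGeometry.HodgeTheory.BlochSemiregularityMapReal
import Literature.AlgebraicGeometry.Modules.SheafHomPushforward
import Literature.AlgebraicGeometry.Modules.SheafHomFunctor
import HarnessLib

/-!
# The iterated internal Hom `multiHom 𝓘 T r` and its alternating part under push-forward along an isomorphism

Layer `Literature/AlgebraicGeometry/HodgeTheory`; companion of `BlochSemiregularityMapReal.lean` (which
defines `multiHom I T r = 𝓗om(I, 𝓗om(I, … T …))`, the evaluation `evalMulti` on tuples of sections, the
alternating subsheaf `altMultiHom I T r = 𝓐lt_r(I; T)` with its inclusion `altι`) and of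
`Modules/SheafHomPushforward.lean` (`ε_* 𝓗om(E, M) ≅ 𝓗om(ε_*E, ε_*M)` for an isomorphism `ε`).
Everything PROVED, no named facts:

* `altLift` — a morphism into `multiHom` with alternating values lifts to `altMultiHom`
  (`altLift_comp_altι`, `altι_app_altLift_app`);
* for an ISOMORPHISM of schemes `ε : Y₀ ≅ Y₁`: **`multiHomPushforwardIso ε I T r :
  ε_* (multiHom I T r) ≅ multiHom (ε_*I) (ε_*T) r`** (induction on `r`), with
  **`evalMulti_multiHomPushforwardIso_hom_app`** (evaluation on tuples is preserved, in
  `Γ(ε_*T, W) = Γ(T, ε⁻¹W)`), `isAltSection_multiHomPushforwardIso_hom_app_iff`, and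
  **`altMultiHomPushforwardIso ε I T r : ε_* 𝓐lt_r(I; T) ≅ 𝓐lt_r(ε_*I; ε_*T)`**
  (`altMultiHomPushforwardHom_comp_altι`).

Motivation (venture HSemireg, bridge (B1), residual gap (T), step W3(c)): the TARGET of Bloch's
pairing `blochPairingAltSheafHom i r j : Ωʲ ⟶ 𝓐lt_r(𝓘; Ωⁿ|_Z)` transports along an isomorphism of the
ambient scheme; what remains for `IsBlochSemiregular.comp_iso` is the change of input data on `Y₁`
(`𝓘_{i≫ε} ≅ ε_*𝓘_i`, `Deformation/IdealModulePushforward`; `Ωⁿ|_Z` via `Modules/PushforwardIsoAdjunction`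
and `HodgeSheafComapIso`) and the naturality of the pairing.

References: R. Hartshorne, *Algebraic Geometry* (1977), II Ex. 1.15 / II.5 p. 109 (sheaf Hom); the
statements are bookkeeping of the tree's constructions along direct images by an isomorphism (reading).
[Hartshorne1977]
-/

noncomputable section

-- `TopCat.Presheaf`/`Scheme.Modules` are not reducible (as in Mathlib's `AlgebraicGeometry/Modules/Sheaf.lean`).
set_option backward.isDefEq.respectTransparency false

open CategoryTheory AlgebraicGeometry Opposite TopologicalSpace

universe u

namespace Literature.AlgebraicGeometry.HodgeTheory

open Literature.AlgebraicGeometry.Modules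

section AltLift

variable {Y : Scheme.{u}} {I T N : Y.Modules} {r : ℕ}

/-- A morphism into `multiHom I T r` all of whose section values are alternating lifts to the
alternating subsheaf `𝓐lt_r(I; T)`. [folklore] -/
def altLift (ψ : N ⟶ multiHom I T r)
    (h : ∀ (U : Y.Opens) (x : Γ(N, U)), IsAltSection I T r U (ψ.app U x)) : N ⟶ altMultiHom I T r where
  val := PresheafOfModules.homMk
    { app := fun U => AddCommGrpCat.ofHom
        ((ψ.val.app U).hom.toAddMonoidHom.codRestrict (altSubmoduleObj I T r U.unop) (h U.unop))
      naturality := fun {U V} l => by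
        ext x
        apply Subtype.ext
        exact PresheafOfModules.naturality_apply ψ.val l x }
    (fun U a x => Subtype.ext ((ψ.val.app U).hom.map_smul a x))

/-- `altLift ψ h ≫ altι = ψ`. [cite: Hartshorne1977, II.5 (sheaf Hom, p. 109; reading: bookkeeping of iterated sheaf Homs along direct images by an isomorphism)] -/
@[simp]
theorem altLift_comp_altι (ψ : N ⟶ multiHom I T r)
    (h : ∀ (U : Y.Opens) (x : Γ(N, U)), IsAltSection I T r U (ψ.app U x)) :
    altLift ψ h ≫ altι I T r = ψ :=
  Scheme.Modules.hom_ext _ _ fun _ => rfl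

/-- Sections of `altLift`: `(altι (altLift ψ h x)) = ψ x`. [cite: Hartshorne1977, II.5 (sheaf Hom, p. 109; reading: bookkeeping of iterated sheaf Homs along direct images by an isomorphism)] -/
theorem altι_app_altLift_app (ψ : N ⟶ multiHom I T r)
    (h : ∀ (U : Y.Opens) (x : Γ(N, U)), IsAltSection I T r U (ψ.app U x)) (U : Y.Opens) (x : Γ(N, U)) :
    (altι I T r).app U ((altLift ψ h).app U x) = ψ.app U x := rfl

end AltLift

section MultiHomPushforward

variable {Y₀ Y₁ : Scheme.{u}} (ε : Y₀ ≅ Y₁) (I T : Y₀.Modules)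

/-- **`ε_* (multiHom I T r) ≅ multiHom (ε_* I) (ε_* T) r`** for an isomorphism of schemes `ε`, by
induction on `r` (`r = 0`: identity; step: `ε_* 𝓗om(I, –) ≅ 𝓗om(ε_*I, ε_* –)` from
`Modules.sheafHomPushforwardIso`, then `𝓗om(ε_*I, –)` of the previous isomorphism). [folklore] -/
def multiHomPushforwardIso : (r : ℕ) →
    ((Scheme.Modules.pushforward ε.hom).obj (multiHom I T r) ≅
      multiHom ((Scheme.Modules.pushforward ε.hom).obj I) ((Scheme.Modules.pushforward ε.hom).obj T) r)
  | 0 => Iso.refl _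
  | r + 1 => sheafHomPushforwardIso ε I (multiHom I T r) ≪≫
      (sheafHomFunctor ((Scheme.Modules.pushforward ε.hom).obj I)).mapIso (multiHomPushforwardIso r)

/-- Unfolding the successor step of `multiHomPushforwardIso` on a section. [cite: Hartshorne1977, II.5 (sheaf Hom, p. 109; reading: bookkeeping of iterated sheaf Homs along direct images by an isomorphism)] -/
theorem multiHomPushforwardIso_succ_hom_app (r : ℕ) (U : Y₁.Opens)
    (φ : Γ((Scheme.Modules.pushforward ε.hom).obj (multiHom I T (r + 1)), U)) :
    (multiHomPushforwardIso ε I T (r + 1)).hom.app U φ =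
      (sheafHomMap _ (multiHomPushforwardIso ε I T r).hom).app U
        ((sheafHomPushforwardComparison ε.hom I (multiHom I T r)).app U φ) := by
  change ((sheafHomPushforwardIso ε I (multiHom I T r)).hom ≫
    (sheafHomFunctor _).map (multiHomPushforwardIso ε I T r).hom).app U φ = _
  rw [Scheme.Modules.Hom.comp_app]
  rfl

/-- **Evaluation on tuples is compatible with `multiHomPushforwardIso`**: the transported section,
evaluated on a tuple `a` of sections of `ε_*I` over `W ≤ U`, is the original section evaluated on the
same tuple read in `Γ(I, ε⁻¹W)` (in `Γ(ε_*T, W) = Γ(T, ε⁻¹W)`). [cite: Hartshorne1977, II.5 (sheaf Hom, p. 109; reading: bookkeeping of iterated sheaf Homs along direct images by an isomorphism)] -/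
theorem evalMulti_multiHomPushforwardIso_hom_app : (r : ℕ) → ∀ {U W : Y₁.Opens}
    (φ : Γ((Scheme.Modules.pushforward ε.hom).obj (multiHom I T r), U)) (k : W ⟶ U)
    (a : Fin r → Γ((Scheme.Modules.pushforward ε.hom).obj I, W)),
    evalMulti _ _ r ((multiHomPushforwardIso ε I T r).hom.app U φ) k a =
      (evalMulti I T r (show Γ(multiHom I T r, ε.hom ⁻¹ᵁ U) from φ) ((Opens.map ε.hom.base).map k)
        (fun s => (a s : Γ(I, ε.hom ⁻¹ᵁ W))) : Γ(T, ε.hom ⁻¹ᵁ W))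
  | 0, _, _, _, _, _ => rfl
  | r + 1, U, W, φ, k, a => by
    rw [evalMulti_succ, evalMulti_succ, multiHomPushforwardIso_succ_hom_app]
    dsimp only [multiHomSucc]
    rw [sheafHomMap_app_apply, appLE_comp_over_map, sheafHomPushforwardComparison_app_apply,
      appLE_pushforwardOverHom, evalMulti_multiHomPushforwardIso_hom_app r]
    rfl

/-- A section of `multiHom I T r` over `ε⁻¹U` is alternating iff its transport to
`multiHom (ε_*I) (ε_*T) r` over `U` is. [cite: Hartshorne1977, II.5 (sheaf Hom, p. 109; reading: bookkeeping of iterated sheaf Homs along direct images by an isomorphism)] -/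
theorem isAltSection_multiHomPushforwardIso_hom_app_iff (r : ℕ) {U : Y₁.Opens}
    (φ : Γ((Scheme.Modules.pushforward ε.hom).obj (multiHom I T r), U)) :
    IsAltSection _ _ r U ((multiHomPushforwardIso ε I T r).hom.app U φ) ↔
      IsAltSection I T r (ε.hom ⁻¹ᵁ U) (show Γ(multiHom I T r, ε.hom ⁻¹ᵁ U) from φ) := by
  constructor
  · intro hφ W' k' a' s t hst hat
    -- transport to `W := ε⁻¹⁻¹ W'`, where `ε⁻¹(W) = W'`
    have key := hφ (Modules.invPreimageHom k')
      (fun j => Modules.toPushforwardSection ε I W' (a' j)) s t hst (by simp only [hat])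
    rw [evalMulti_multiHomPushforwardIso_hom_app] at key
    have hk : (Opens.map ε.hom.base).map (Modules.invPreimageHom k') =
        eqToHom (Modules.preimage_hom_preimage_inv ε W') ≫ k' := Subsingleton.elim _ _
    rw [hk] at key
    change evalMulti I T r φ (eqToHom _ ≫ k') (fun j => I.presheaf.map (eqToHom _).op (a' j)) = 0 at key
    rw [← map_evalMulti] at key
    -- `T.map (eqToHom).op (evalMulti φ k' a') = 0` ⇒ `evalMulti φ k' a' = 0`
    have h2 := congrArg (T.presheaf.map (eqToHom (Modules.preimage_hom_preimage_inv ε W').symm).op) key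
    rw [map_zero, ← CategoryTheory.comp_apply, ← T.presheaf.map_comp, ← op_comp, eqToHom_trans, eqToHom_refl,
      op_id, T.presheaf.map_id] at h2
    exact h2
  · intro hφ W k a s t hst hat
    rw [evalMulti_multiHomPushforwardIso_hom_app]
    exact hφ ((Opens.map ε.hom.base).map k) (fun j => (a j : Γ(I, ε.hom ⁻¹ᵁ W))) s t hst
      (by simp only [hat])

/-- **`ε_* 𝓐lt_r(I; T) ⟶ 𝓐lt_r(ε_*I; ε_*T)`**: `ε_*` of the inclusion, transported by
`multiHomPushforwardIso`, lifted to the alternating subsheaf. [folklore] -/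
def altMultiHomPushforwardHom (r : ℕ) :
    (Scheme.Modules.pushforward ε.hom).obj (altMultiHom I T r) ⟶
      altMultiHom ((Scheme.Modules.pushforward ε.hom).obj I) ((Scheme.Modules.pushforward ε.hom).obj T) r :=
  altLift ((Scheme.Modules.pushforward ε.hom).map (altι I T r) ≫ (multiHomPushforwardIso ε I T r).hom)
    (fun U x => (isAltSection_multiHomPushforwardIso_hom_app_iff ε I T r _).mpr
      (isAltSection_altι_app I T r (ε.hom ⁻¹ᵁ U) x))

/-- `altMultiHomPushforwardHom ≫ altι = ε_*(altι) ≫ multiHomPushforwardIso.hom`. [cite: Hartshorne1977, II.5 (sheaf Hom, p. 109; reading: bookkeeping of iterated sheaf Homs along direct images by an isomorphism)] -/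
@[simp]
theorem altMultiHomPushforwardHom_comp_altι (r : ℕ) :
    altMultiHomPushforwardHom ε I T r ≫ altι _ _ r =
      (Scheme.Modules.pushforward ε.hom).map (altι I T r) ≫ (multiHomPushforwardIso ε I T r).hom :=
  altLift_comp_altι _ _

/-- **`ε_* 𝓐lt_r(I; T) ⟶ 𝓐lt_r(ε_*I; ε_*T)` is an isomorphism** (bijective on sections: injective as a
lift of a mono through a mono; surjective because the inverse transport of an alternating section is
alternating). [folklore] -/
instance isIso_altMultiHomPushforwardHom (r : ℕ) : IsIso (altMultiHomPushforwardHom ε I T r) := by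
  refine Scheme.Modules.Hom.isIso_iff_isIso_app.mpr fun U => ?_
  rw [ConcreteCategory.isIso_iff_bijective]
  constructor
  · intro x y hxy
    have h := congrArg ((altι _ _ r).app U) hxy
    rw [altMultiHomPushforwardHom, altι_app_altLift_app, altι_app_altLift_app] at h
    change (multiHomPushforwardIso ε I T r).hom.app U ((altι I T r).app (ε.hom ⁻¹ᵁ U) x) =
      (multiHomPushforwardIso ε I T r).hom.app U ((altι I T r).app (ε.hom ⁻¹ᵁ U) y) at h
    have hinj : Function.Injective ((multiHomPushforwardIso ε I T r).hom.app U) :=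
      (ConcreteCategory.bijective_of_isIso ((multiHomPushforwardIso ε I T r).hom.app U)).1
    exact altι_app_injective I T r (ε.hom ⁻¹ᵁ U) (hinj h)
  · rintro ψ
    -- the candidate preimage: the inverse transport of the underlying section, which is alternating
    let φ : Γ((Scheme.Modules.pushforward ε.hom).obj (multiHom I T r), U) :=
      (multiHomPushforwardIso ε I T r).inv.app U ((altι _ _ r).app U ψ)
    have hφ' : (multiHomPushforwardIso ε I T r).hom.app U φ = (altι _ _ r).app U ψ := by
      change ((multiHomPushforwardIso ε I T r).inv ≫ (multiHomPushforwardIso ε I T r).hom).app U _ = _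
      rw [Iso.inv_hom_id, Scheme.Modules.Hom.id_app]
      rfl
    have halt : IsAltSection I T r (ε.hom ⁻¹ᵁ U) (show Γ(multiHom I T r, ε.hom ⁻¹ᵁ U) from φ) := by
      rw [← isAltSection_multiHomPushforwardIso_hom_app_iff, hφ']
      exact isAltSection_altι_app _ _ r U ψ
    refine ⟨(⟨φ, halt⟩ : altSubmoduleObj I T r (ε.hom ⁻¹ᵁ U)), ?_⟩
    apply altι_app_injective _ _ r U
    rw [altMultiHomPushforwardHom, altι_app_altLift_app]
    exact hφ'

/-- **`ε_* 𝓐lt_r(I; T) ≅ 𝓐lt_r(ε_*I; ε_*T)`** for an isomorphism of schemes `ε`. [folklore] -/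
def altMultiHomPushforwardIso (r : ℕ) :
    (Scheme.Modules.pushforward ε.hom).obj (altMultiHom I T r) ≅
      altMultiHom ((Scheme.Modules.pushforward ε.hom).obj I) ((Scheme.Modules.pushforward ε.hom).obj T) r :=
  asIso (altMultiHomPushforwardHom ε I T r)

end MultiHomPushforward

end Literature.AlgebraicGeometry.HodgeTheory

end
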